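import Summits.MatrixMultiplication.MatrixMultiplication.Theorems.AbelianSTPPCensusTAStatDefs

/-!
# T_A certificate past 1700 (static t*-indexed linear checker): kernel evaluation, shape checks, volumes `4411 … 5000`

Cell mm-stpp (rung F-M1), threshold T_A = `τ = 2.371`; checker and design in `AbelianSTPPCensusTAStatDefs.lean`, table in
`AbelianSTPPCensusTAStatData.lean`.  `decide` with kernel reduction (standard axioms; no `native_decide`), `Elab.async false`, one theorem per
chunk of volumes; consumed by `TAStat.checkV_sound` / `TAStat.domV_sound` (`AbelianSTPPCensusTAStatRows.lean`) in the leaf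
`AbelianSTPPCensusLeafTA5000Closed.lean`.
WHAT THIS IS NOT: arithmetic on shape lists only; no statement about STPP families or `ω`.
-/

set_option linter.dupNamespace false
set_option autoImplicit false
set_option Elab.async false

namespace Summit.MatrixMultiplication.MatrixMultiplication.Theorems.TAStat

set_option maxHeartbeats 0 in
/-- Check chunk: every sorted candidate shape of the volumes `4411 … 4624` passes `checkShape` (45319 (shape, bucket) checks). [original] -/
theorem ck4411 : checkV 214 4411 = true := by decide +kernel

set_option maxHeartbeats 0 in
/-- Check chunk: every sorted candidate shape of the volumes `4625 … 5000` passes `checkShape` (35892 (shape, bucket) checks). [original] -/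
theorem ck4625 : checkV 376 4625 = true := by decide +kernel

end Summit.MatrixMultiplication.MatrixMultiplication.Theorems.TAStat
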